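import Summits.Parity.GeneralizedHardyLittlewood.Theorems.LeeYangFibresRelativeDimOneMoebiusSplitSingularSeriesAux8
import HarnessLib

/-!
# Crux `RelativeDimOne` (stmt-Parity-14113), line `single-moebius-split`, stub `stub_tssInduction`:
# auxiliary file 9 — the inner errors of the induction step; the base case

Induction step `t → t + 1` of `TSSInduction`, part 4.

* `tssI_inner`: the class of data is closed under conditioning. For data `(W, Z, P, Q, R, Rmin, Rmax, y)`
  satisfying the hypotheses of `TSSInduction (t+1)` and `1 ≤ x ≤ R_t`, the conditioned data
  `(W^{(x)}, Z', P ∪ pf(x), Q, R', Rmin, Rmax, y)` (`W^{(x)}_p = W_p ∩ Z_{p,t}` at `p ∣ x`, first `t` root sets and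
  levels) satisfy the hypotheses of `TSSInduction t`: the new frozen primes are below `y` (`p ≤ x ≤ R_t < y`), off
  `P ∪ pf(x)` nothing changed, and the staggering survives because `∏_{P ∪ pf x} p ≤ (∏_P p) x ≤ (∏_P p) R_t`
  (`TSSInd.stagger_cond`). Feeding the induction hypothesis (an explicit hypothesis with constants `c, m, κ, C`) and
  `∏_{p ∈ P ∪ pf x} |W^{(x)}_p|/p ≤ (∏_{p∈P} |W_p|/p) ∏_{p ∣ x, p ∉ P} 1/p` (`|W^{(x)}_p| ≤ |Z_{p,t}| ≤ 1` off `P`):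
  the inner error at `x` is the generic error `E₀` times `∏_{p∣x, p∉P} κ/p`.
* `tssI_inner_sum` (registered): summing against `|μ(x)| log(R_t/x) ≤ log Rmax` over `x ≤ R_t` with the
  divisor-type sum `tssI_sum_frozen_weights` (`κ ≤ Λ ∈ ℕ`):
  `|∑_{x ≤ R_t} μ(x) log(R_t/x) (GY_t(W^{(x)}) − ∏ β(W^{(x)}))| ≤ E₀ (log Rmax)^{Λ+1} 2^{|P|} e^{4Λ}`.
* `TSSInd.base`: the case `t = 0` (no variable: both sides equal `∏_{p<y} |W_p|/p`).

References: D. A. Goldston, C. Y. Yıldırım, Integers 3 (2003) A5 = arXiv:math/0111212, §3 [GoldstonYildirim2001].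
-/

noncomputable section

open Finset Real
open scoped BigOperators

namespace Summit.Parity.GeneralizedHardyLittlewood.Cruxes.RelativeDimOne.SingleMoebiusSplit

/-! ### The inner error at one `x` -/

open TSSInd in
/-- **The inner error at one value `x` of the peeled variable** (aux lemma of `stub_tssInduction`):
if the `t`-variable statement holds with constants `(c, m, κ, C)` (hypothesis), then for data satisfying the
hypotheses of the `(t+1)`-variable statement and `1 ≤ x ≤ R_t`,
`|GY_t(R', g_{W^{(x)},Z'}; y) − ∏_{p<y} β_p(W^{(x)}, Z')| ≤ C κ^{|P|} Θ_Q (∏_{p∈P}|W_p|/p) (log Rmax)^m e^{−c√log Rmin} · κ^{#(pf x ∖ P)} ∏_{p∣x, p∉P} 1/p`.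
[cite: GoldstonYildirim2001, Lemma 2.1] -/
theorem tssI_inner : ∀ (t : ℕ) (c : ℝ) (m : ℕ) (κ C B : ℝ), 0 ≤ κ → 0 ≤ C →
    (∀ (W : ℕ → Finset ℕ) (Z : ℕ → Fin t → Finset ℕ) (P Q : Finset ℕ) (R : Fin t → ℝ)
      (Rmin Rmax : ℝ) (y : ℕ),
      (∀ p ∈ P, p.Prime) → (∀ p ∈ Q, p.Prime) →
      (∀ p ∈ P, W p ⊆ Finset.range p) →
      (∀ p : ℕ, p.Prime → p ∉ P → W p = Finset.range p ∧ 2 * t < p ∧ ∀ i, (Z p i).card ≤ 1) →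
      (∀ p : ℕ, p.Prime → p ∉ P → p ∉ Q →
        ∀ i : Fin t, ∃ r : ℕ, r < p ∧ Z p i = {r} ∧ ∀ j : Fin t, j ≠ i → r ∉ Z p j) →
      8 ≤ Rmin → (∀ i, Rmin ≤ R i ∧ R i ≤ Rmax) →
      (∀ i, ⌊R i⌋₊ < y) → (∀ p ∈ P, p < y) →
      (∀ i : Fin t, (∏ p ∈ P, (p : ℝ)) ^ 3 * (∏ j ∈ Finset.Ioi i, R j) ^ 3 ≤ R i ^ 2) →
      (Q.card : ℝ) ≤ B * Real.log Rmin →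
        |gySum R (gyWeight W Z) y - ∏ p ∈ Nat.primesBelow y, gyLocalFactor W Z p| ≤
          C * κ ^ P.card * (∏ p ∈ Q, ((p : ℝ) / ((p : ℝ) - 1)) ^ t) *
            (∏ p ∈ P, (((W p).card : ℝ) / p)) * Real.log Rmax ^ m *
              Real.exp (-(c * Real.sqrt (Real.log Rmin)))) →
    ∀ (W : ℕ → Finset ℕ) (Z : ℕ → Fin (t + 1) → Finset ℕ) (P Q : Finset ℕ) (R : Fin (t + 1) → ℝ)
      (Rmin Rmax : ℝ) (y : ℕ),
      (∀ p ∈ P, p.Prime) → (∀ p ∈ Q, p.Prime) →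
      (∀ p ∈ P, W p ⊆ Finset.range p) →
      (∀ p : ℕ, p.Prime → p ∉ P → W p = Finset.range p ∧ 2 * (t + 1) < p ∧ ∀ i, (Z p i).card ≤ 1) →
      (∀ p : ℕ, p.Prime → p ∉ P → p ∉ Q →
        ∀ i : Fin (t + 1), ∃ r : ℕ, r < p ∧ Z p i = {r} ∧ ∀ j : Fin (t + 1), j ≠ i → r ∉ Z p j) →
      8 ≤ Rmin → (∀ i, Rmin ≤ R i ∧ R i ≤ Rmax) →
      (∀ i, ⌊R i⌋₊ < y) → (∀ p ∈ P, p < y) →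
      (∀ i : Fin (t + 1), (∏ p ∈ P, (p : ℝ)) ^ 3 * (∏ j ∈ Finset.Ioi i, R j) ^ 3 ≤ R i ^ 2) →
      (Q.card : ℝ) ≤ B * Real.log Rmin →
      ∀ x ∈ Finset.Icc 1 ⌊R (Fin.last t)⌋₊,
        |gySum (fun i => R (Fin.castSucc i))
              (gyWeight (fun q => if q ∣ x then (W q).filter (fun r => r ∈ Z q (Fin.last t)) else W q)
                (fun q i => Z q (Fin.castSucc i))) y -
            ∏ p ∈ Nat.primesBelow y,
              gyLocalFactor (fun q => if q ∣ x then (W q).filter (fun r => r ∈ Z q (Fin.last t)) else W q)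
                (fun q i => Z q (Fin.castSucc i)) p| ≤
          C * κ ^ P.card * (∏ p ∈ Q, ((p : ℝ) / ((p : ℝ) - 1)) ^ t) *
            (∏ p ∈ P, (((W p).card : ℝ) / p)) * Real.log Rmax ^ m *
              Real.exp (-(c * Real.sqrt (Real.log Rmin))) *
                (κ ^ (x.primeFactors \ P).card * ∏ p ∈ x.primeFactors \ P, (1 : ℝ) / p) := by
  intro t c m κ C B hκ hC hIH W Z P Q R Rmin Rmax y hP hQ hWP hoff hgen hRmin hR hy hPy hstag hQc x hx
  obtain ⟨hx1, hxR⟩ := Finset.mem_Icc.1 hx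
  have hx0 : x ≠ 0 := by omega
  have hR0 : ∀ i, 0 ≤ R i := fun i => le_trans (by norm_num) (hRmin.trans (hR i).1)
  have hxR' : (x : ℝ) ≤ R (Fin.last t) := by
    have h1 : ((⌊R (Fin.last t)⌋₊ : ℕ) : ℝ) ≤ R (Fin.last t) := Nat.floor_le (hR0 _)
    have h2 : (x : ℝ) ≤ ((⌊R (Fin.last t)⌋₊ : ℕ) : ℝ) := by exact_mod_cast hxR
    linarith
  have hxy : x < y := lt_of_le_of_lt hxR (hy _)
  -- the conditioned data
  set P' : Finset ℕ := P ∪ x.primeFactors with hP'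
  set Wx : ℕ → Finset ℕ := fun q => if q ∣ x then (W q).filter (fun r => r ∈ Z q (Fin.last t)) else W q with hWx
  set Z' : ℕ → Fin t → Finset ℕ := fun q i => Z q (Fin.castSucc i) with hZ'
  set R' : Fin t → ℝ := fun i => R (Fin.castSucc i) with hR'
  -- its hypotheses
  have hP'p : ∀ p ∈ P', p.Prime := fun p hp => by
    rcases Finset.mem_union.1 hp with h | h
    · exact hP p h
    · exact Nat.prime_of_mem_primeFactors h
  have hWP' : ∀ p ∈ P', Wx p ⊆ Finset.range p := by
    intro p hp
    by_cases hpP : p ∈ P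
    · simp only [hWx]
      split_ifs
      · exact (Finset.filter_subset _ _).trans (hWP p hpP)
      · exact hWP p hpP
    · have hpf : p ∈ x.primeFactors := (Finset.mem_union.1 hp).resolve_left hpP
      have hpx : p ∣ x := Nat.dvd_of_mem_primeFactors hpf
      obtain ⟨hW, -, -⟩ := hoff p (Nat.prime_of_mem_primeFactors hpf) hpP
      simp only [hWx, if_pos hpx, hW]
      exact Finset.filter_subset _ _
  have hoff' : ∀ p : ℕ, p.Prime → p ∉ P' → Wx p = Finset.range p ∧ 2 * t < p ∧ ∀ i, (Z' p i).card ≤ 1 := by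
    intro p hp hpP'
    rw [hP', Finset.mem_union, not_or] at hpP'
    have hpx : ¬ p ∣ x := fun h => hpP'.2 (Nat.mem_primeFactors.2 ⟨hp, h, hx0⟩)
    obtain ⟨hW, htp, hZ⟩ := hoff p hp hpP'.1
    exact ⟨by simp only [hWx, if_neg hpx, hW], by omega, fun i => hZ _⟩
  have hgen' : ∀ p : ℕ, p.Prime → p ∉ P' → p ∉ Q →
      ∀ i : Fin t, ∃ r : ℕ, r < p ∧ Z' p i = {r} ∧ ∀ j : Fin t, j ≠ i → r ∉ Z' p j := by
    intro p hp hpP' hpQ i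
    rw [hP', Finset.mem_union, not_or] at hpP'
    obtain ⟨r, hr, hZi, hne⟩ := hgen p hp hpP'.1 hpQ (Fin.castSucc i)
    exact ⟨r, hr, hZi, fun j hj => hne (Fin.castSucc j) fun h => hj (Fin.castSucc_injective _ h)⟩
  have hRb' : ∀ i, Rmin ≤ R' i ∧ R' i ≤ Rmax := fun i => hR _
  have hy' : ∀ i, ⌊R' i⌋₊ < y := fun i => hy _
  have hPy' : ∀ p ∈ P', p < y := fun p hp => by
    rcases Finset.mem_union.1 hp with h | h
    · exact hPy p h
    · exact lt_of_le_of_lt (Nat.le_of_mem_primeFactors h) hxy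
  have hstag' : ∀ i : Fin t, (∏ p ∈ P', (p : ℝ)) ^ 3 * (∏ j ∈ Finset.Ioi i, R' j) ^ 3 ≤ R' i ^ 2 :=
    fun i => stagger_cond P R hx0 hxR' hR0 hstag i
  have hinner := hIH Wx Z' P' Q R' Rmin Rmax y hP'p hQ hWP' hoff' hgen' hRmin hRb' hy' hPy' hstag' hQc
  refine hinner.trans ?_
  -- the new frozen product
  have hZl : ∀ p ∈ x.primeFactors \ P, (Z p (Fin.last t)).card ≤ 1 := fun p hp => by
    obtain ⟨hp1, hpP⟩ := Finset.mem_sdiff.1 hp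
    exact (hoff p (Nat.prime_of_mem_primeFactors hp1) hpP).2.2 _
  have hprodW : ∏ p ∈ P', ((((Wx p).card : ℕ) : ℝ) / p) ≤
      (∏ p ∈ P, ((((W p).card : ℕ) : ℝ) / p)) * ∏ p ∈ x.primeFactors \ P, (1 : ℝ) / p :=
    prod_cond_window_le W Z P x hZl
  have hΘ0 : 0 ≤ ∏ p ∈ Q, ((p : ℝ) / ((p : ℝ) - 1)) ^ t := Finset.prod_nonneg fun p _ => pow_nonneg (div_pred_nonneg p) _
  have hL0 : 0 ≤ Real.log Rmax := by
    have h : (1 : ℝ) ≤ Rmax := le_trans (by norm_num) ((hRmin.trans (hR (Fin.last t)).1).trans (hR (Fin.last t)).2)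
    exact Real.log_nonneg h
  have hK0 : 0 ≤ C * κ ^ P'.card * (∏ p ∈ Q, ((p : ℝ) / ((p : ℝ) - 1)) ^ t) * Real.log Rmax ^ m *
      Real.exp (-(c * Real.sqrt (Real.log Rmin))) :=
    mul_nonneg (mul_nonneg (mul_nonneg (mul_nonneg hC (pow_nonneg hκ _)) hΘ0) (pow_nonneg hL0 _)) (Real.exp_nonneg _)
  calc C * κ ^ P'.card * (∏ p ∈ Q, ((p : ℝ) / ((p : ℝ) - 1)) ^ t) * (∏ p ∈ P', ((((Wx p).card : ℕ) : ℝ) / p)) *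
        Real.log Rmax ^ m * Real.exp (-(c * Real.sqrt (Real.log Rmin)))
      = C * κ ^ P'.card * (∏ p ∈ Q, ((p : ℝ) / ((p : ℝ) - 1)) ^ t) * Real.log Rmax ^ m *
          Real.exp (-(c * Real.sqrt (Real.log Rmin))) * (∏ p ∈ P', ((((Wx p).card : ℕ) : ℝ) / p)) := by ring
    _ ≤ C * κ ^ P'.card * (∏ p ∈ Q, ((p : ℝ) / ((p : ℝ) - 1)) ^ t) * Real.log Rmax ^ m *
          Real.exp (-(c * Real.sqrt (Real.log Rmin))) *
          ((∏ p ∈ P, ((((W p).card : ℕ) : ℝ) / p)) * ∏ p ∈ x.primeFactors \ P, (1 : ℝ) / p) :=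
        mul_le_mul_of_nonneg_left hprodW hK0
    _ = _ := by rw [hP', card_union_primeFactors, pow_add]; ring


namespace TSSInd

/-! ### The base case `t = 0` -/

/-- With no form, every weight is `|W_p|/p`. [folklore] -/
theorem gyWeight_fin_zero (W : ℕ → Finset ℕ) (Z : ℕ → Fin 0 → Finset ℕ) (p : ℕ) (S : Finset (Fin 0)) :
    gyWeight W Z p S = ((((W p).card : ℕ) : ℝ)) / p := by
  unfold gyWeight
  rw [Finset.filter_true_of_mem fun r _ i _ => i.elim0]

/-- With no form, the local factor is `|W_p|/p`. [folklore] -/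
theorem gyLocalFactor_fin_zero (W : ℕ → Finset ℕ) (Z : ℕ → Fin 0 → Finset ℕ) (p : ℕ) :
    gyLocalFactor W Z p = ((((W p).card : ℕ) : ℝ)) / p := by
  unfold gyLocalFactor
  rw [pow_zero, one_mul, Finset.filter_true_of_mem fun r _ i => i.elim0]

/-- With no variable, `GY_0(g; y) = ∏_{p<y} |W_p|/p`. [folklore] -/
theorem gySum_fin_zero (R : Fin 0 → ℝ) (W : ℕ → Finset ℕ) (Z : ℕ → Fin 0 → Finset ℕ) (y : ℕ) :
    gySum R (gyWeight W Z) y = ∏ p ∈ Nat.primesBelow y, ((((W p).card : ℕ) : ℝ)) / p := by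
  unfold gySum
  rw [Fintype.piFinset_of_isEmpty, Fintype.sum_unique, Fin.prod_univ_zero, one_mul]
  exact Finset.prod_congr rfl fun p _ => gyWeight_fin_zero W Z p _

/-- **Base case** `TSSInduction 0`: both sides equal `∏_{p<y} |W_p|/p`. [folklore] -/
theorem base : TSSInduction 0 := by
  refine ⟨1, one_pos, 0, 1, le_rfl, fun _ _ => ⟨0, le_rfl, ?_⟩⟩
  intro W Z P Q R Rmin Rmax y _ _ _ _ _ _ _ _ _ _ _
  have h : gySum R (gyWeight W Z) y = ∏ p ∈ Nat.primesBelow y, gyLocalFactor W Z p := by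
    rw [gySum_fin_zero]
    exact Finset.prod_congr rfl fun p _ => (gyLocalFactor_fin_zero W Z p).symm
  rw [h, sub_self, abs_zero]
  simp

end TSSInd

/-! ### The registered sub-goal of this file: the inner errors summed over the peeled variable -/

open TSSInd in
/-- **The inner errors summed over the peeled variable** (sub-goal `tssI_inner_sum` of `stub_tssInduction`): if the
`t`-variable statement holds with constants `(c, m, κ, C)` and `κ ≤ Λ ∈ ℕ`, then for data satisfying the hypotheses of
the `(t+1)`-variable statement,
`|∑_{x ≤ R_t} μ(x) log(R_t/x) (GY_t(R', g_{W^{(x)},Z'}; y) − ∏_{p<y} β_p(W^{(x)}, Z'))| ≤ C κ^{|P|} Θ_Q (∏_{p∈P}|W_p|/p) (log Rmax)^m e^{−c√log Rmin} · (log Rmax)^{Λ+1} 2^{|P|} e^{4Λ}`.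
[cite: GoldstonYildirim2001, Lemma 2.1] -/
theorem tssI_inner_sum : ∀ (t : ℕ) (c : ℝ) (m : ℕ) (κ C B : ℝ) (Lam : ℕ), 0 ≤ κ → κ ≤ Lam → 0 ≤ C →
    (∀ (W : ℕ → Finset ℕ) (Z : ℕ → Fin t → Finset ℕ) (P Q : Finset ℕ) (R : Fin t → ℝ)
      (Rmin Rmax : ℝ) (y : ℕ),
      (∀ p ∈ P, p.Prime) → (∀ p ∈ Q, p.Prime) →
      (∀ p ∈ P, W p ⊆ Finset.range p) →
      (∀ p : ℕ, p.Prime → p ∉ P → W p = Finset.range p ∧ 2 * t < p ∧ ∀ i, (Z p i).card ≤ 1) →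
      (∀ p : ℕ, p.Prime → p ∉ P → p ∉ Q →
        ∀ i : Fin t, ∃ r : ℕ, r < p ∧ Z p i = {r} ∧ ∀ j : Fin t, j ≠ i → r ∉ Z p j) →
      8 ≤ Rmin → (∀ i, Rmin ≤ R i ∧ R i ≤ Rmax) →
      (∀ i, ⌊R i⌋₊ < y) → (∀ p ∈ P, p < y) →
      (∀ i : Fin t, (∏ p ∈ P, (p : ℝ)) ^ 3 * (∏ j ∈ Finset.Ioi i, R j) ^ 3 ≤ R i ^ 2) →
      (Q.card : ℝ) ≤ B * Real.log Rmin →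
        |gySum R (gyWeight W Z) y - ∏ p ∈ Nat.primesBelow y, gyLocalFactor W Z p| ≤
          C * κ ^ P.card * (∏ p ∈ Q, ((p : ℝ) / ((p : ℝ) - 1)) ^ t) *
            (∏ p ∈ P, (((W p).card : ℝ) / p)) * Real.log Rmax ^ m *
              Real.exp (-(c * Real.sqrt (Real.log Rmin)))) →
    ∀ (W : ℕ → Finset ℕ) (Z : ℕ → Fin (t + 1) → Finset ℕ) (P Q : Finset ℕ) (R : Fin (t + 1) → ℝ)
      (Rmin Rmax : ℝ) (y : ℕ),
      (∀ p ∈ P, p.Prime) → (∀ p ∈ Q, p.Prime) →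
      (∀ p ∈ P, W p ⊆ Finset.range p) →
      (∀ p : ℕ, p.Prime → p ∉ P → W p = Finset.range p ∧ 2 * (t + 1) < p ∧ ∀ i, (Z p i).card ≤ 1) →
      (∀ p : ℕ, p.Prime → p ∉ P → p ∉ Q →
        ∀ i : Fin (t + 1), ∃ r : ℕ, r < p ∧ Z p i = {r} ∧ ∀ j : Fin (t + 1), j ≠ i → r ∉ Z p j) →
      8 ≤ Rmin → (∀ i, Rmin ≤ R i ∧ R i ≤ Rmax) →
      (∀ i, ⌊R i⌋₊ < y) → (∀ p ∈ P, p < y) →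
      (∀ i : Fin (t + 1), (∏ p ∈ P, (p : ℝ)) ^ 3 * (∏ j ∈ Finset.Ioi i, R j) ^ 3 ≤ R i ^ 2) →
      (Q.card : ℝ) ≤ B * Real.log Rmin →
        |∑ x ∈ Finset.Icc 1 ⌊R (Fin.last t)⌋₊, ((ArithmeticFunction.moebius x : ℤ) : ℝ) *
            Real.log (R (Fin.last t) / x) *
            (gySum (fun i => R (Fin.castSucc i))
                (gyWeight (fun q => if q ∣ x then (W q).filter (fun r => r ∈ Z q (Fin.last t)) else W q)
                  (fun q i => Z q (Fin.castSucc i))) y -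
              ∏ p ∈ Nat.primesBelow y,
                gyLocalFactor (fun q => if q ∣ x then (W q).filter (fun r => r ∈ Z q (Fin.last t)) else W q)
                  (fun q i => Z q (Fin.castSucc i)) p)| ≤
          C * κ ^ P.card * (∏ p ∈ Q, ((p : ℝ) / ((p : ℝ) - 1)) ^ t) *
            (∏ p ∈ P, (((W p).card : ℝ) / p)) * Real.log Rmax ^ m *
              Real.exp (-(c * Real.sqrt (Real.log Rmin))) *
                (Real.log Rmax ^ (Lam + 1) * (2 ^ P.card * Real.exp (4 * Lam))) := by
  intro t c m κ C B Lam hκ hκL hC hIH W Z P Q R Rmin Rmax y hP hQ hWP hoff hgen hRmin hR hy hPy hstag hQc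
  set E₀ : ℝ := C * κ ^ P.card * (∏ p ∈ Q, ((p : ℝ) / ((p : ℝ) - 1)) ^ t) *
    (∏ p ∈ P, (((W p).card : ℝ) / p)) * Real.log Rmax ^ m * Real.exp (-(c * Real.sqrt (Real.log Rmin))) with hE₀
  have hRL8 : 8 ≤ R (Fin.last t) := hRmin.trans (hR _).1
  have hRL0 : 0 < R (Fin.last t) := by linarith
  have hLmax : Real.log (R (Fin.last t)) ≤ Real.log Rmax := Real.log_le_log hRL0 (hR _).2
  have hL0 : 0 ≤ Real.log Rmax := (Real.log_nonneg (by linarith)).trans hLmax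
  have hΘ0 : 0 ≤ ∏ p ∈ Q, ((p : ℝ) / ((p : ℝ) - 1)) ^ t := Finset.prod_nonneg fun p _ => pow_nonneg (div_pred_nonneg p) _
  have hW0 : 0 ≤ ∏ p ∈ P, (((W p).card : ℝ) / p) :=
    Finset.prod_nonneg fun p _ => div_nonneg (Nat.cast_nonneg _) (Nat.cast_nonneg _)
  have hE₀0 : 0 ≤ E₀ :=
    mul_nonneg (mul_nonneg (mul_nonneg (mul_nonneg (mul_nonneg hC (pow_nonneg hκ _)) hΘ0) hW0) (pow_nonneg hL0 _))
      (Real.exp_nonneg _)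
  -- termwise
  have hterm : ∀ x ∈ Finset.Icc 1 ⌊R (Fin.last t)⌋₊,
      |((ArithmeticFunction.moebius x : ℤ) : ℝ) * Real.log (R (Fin.last t) / x) *
          (gySum (fun i => R (Fin.castSucc i))
              (gyWeight (fun q => if q ∣ x then (W q).filter (fun r => r ∈ Z q (Fin.last t)) else W q)
                (fun q i => Z q (Fin.castSucc i))) y -
            ∏ p ∈ Nat.primesBelow y,
              gyLocalFactor (fun q => if q ∣ x then (W q).filter (fun r => r ∈ Z q (Fin.last t)) else W q)
                (fun q i => Z q (Fin.castSucc i)) p)| ≤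
        Real.log Rmax * E₀ * (|((ArithmeticFunction.moebius x : ℤ) : ℝ)| *
          (((Lam : ℕ) : ℝ) ^ (x.primeFactors \ P).card * ∏ p ∈ x.primeFactors \ P, (1 : ℝ) / p)) := by
    intro x hx
    have hin := tssI_inner t c m κ C B hκ hC hIH W Z P Q R Rmin Rmax y hP hQ hWP hoff hgen hRmin hR hy hPy hstag
      hQc x hx
    obtain ⟨hx1, hxR⟩ := Finset.mem_Icc.1 hx
    have hx0' : (0 : ℝ) < x := by exact_mod_cast hx1
    have hxRL : (x : ℝ) ≤ R (Fin.last t) :=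
      le_trans (by exact_mod_cast hxR) (Nat.floor_le hRL0.le)
    have hlog0 : 0 ≤ Real.log (R (Fin.last t) / x) := Real.log_nonneg ((one_le_div hx0').2 hxRL)
    have hlog1 : Real.log (R (Fin.last t) / x) ≤ Real.log Rmax :=
      (Real.log_le_log (div_pos hRL0 hx0') (div_le_self hRL0.le (by exact_mod_cast hx1))).trans hLmax
    have hD0 : 0 ≤ ∏ p ∈ x.primeFactors \ P, (1 : ℝ) / p := Finset.prod_nonneg fun p _ => by positivity
    have hκD : κ ^ (x.primeFactors \ P).card * ∏ p ∈ x.primeFactors \ P, (1 : ℝ) / p ≤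
        ((Lam : ℕ) : ℝ) ^ (x.primeFactors \ P).card * ∏ p ∈ x.primeFactors \ P, (1 : ℝ) / p :=
      mul_le_mul_of_nonneg_right (pow_le_pow_left₀ hκ hκL _) hD0
    rw [abs_mul, abs_mul, abs_of_nonneg hlog0]
    calc |((ArithmeticFunction.moebius x : ℤ) : ℝ)| * Real.log (R (Fin.last t) / x) *
          |gySum (fun i => R (Fin.castSucc i))
              (gyWeight (fun q => if q ∣ x then (W q).filter (fun r => r ∈ Z q (Fin.last t)) else W q)
                (fun q i => Z q (Fin.castSucc i))) y -
            ∏ p ∈ Nat.primesBelow y,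
              gyLocalFactor (fun q => if q ∣ x then (W q).filter (fun r => r ∈ Z q (Fin.last t)) else W q)
                (fun q i => Z q (Fin.castSucc i)) p|
        ≤ |((ArithmeticFunction.moebius x : ℤ) : ℝ)| * Real.log Rmax *
            (E₀ * (κ ^ (x.primeFactors \ P).card * ∏ p ∈ x.primeFactors \ P, (1 : ℝ) / p)) :=
          mul_le_mul (mul_le_mul_of_nonneg_left hlog1 (abs_nonneg _)) hin (abs_nonneg _) (by positivity)
      _ ≤ |((ArithmeticFunction.moebius x : ℤ) : ℝ)| * Real.log Rmax *
            (E₀ * (((Lam : ℕ) : ℝ) ^ (x.primeFactors \ P).card * ∏ p ∈ x.primeFactors \ P, (1 : ℝ) / p)) :=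
          mul_le_mul_of_nonneg_left (mul_le_mul_of_nonneg_left hκD hE₀0) (by positivity)
      _ = _ := by ring
  -- the divisor-type sum
  have hX2 : 2 ≤ ⌊R (Fin.last t)⌋₊ := Nat.le_floor (by push_cast; linarith)
  have hsum := tssI_sum_frozen_weights P Lam ⌊R (Fin.last t)⌋₊ hX2
  have hX0 : (0 : ℝ) < ((⌊R (Fin.last t)⌋₊ : ℕ) : ℝ) := by exact_mod_cast (show 0 < ⌊R (Fin.last t)⌋₊ by omega)
  have hlogX : Real.log ((⌊R (Fin.last t)⌋₊ : ℕ) : ℝ) ≤ Real.log Rmax :=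
    (Real.log_le_log hX0 (Nat.floor_le hRL0.le)).trans hLmax
  have hlogX0 : 0 ≤ Real.log ((⌊R (Fin.last t)⌋₊ : ℕ) : ℝ) :=
    Real.log_nonneg (by exact_mod_cast (show 1 ≤ ⌊R (Fin.last t)⌋₊ by omega))
  have hpowX : Real.log ((⌊R (Fin.last t)⌋₊ : ℕ) : ℝ) ^ Lam ≤ Real.log Rmax ^ Lam := pow_le_pow_left₀ hlogX0 hlogX _
  refine (Finset.abs_sum_le_sum_abs _ _).trans ((Finset.sum_le_sum hterm).trans ?_)
  rw [← Finset.mul_sum]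
  calc Real.log Rmax * E₀ * ∑ x ∈ Finset.Icc 1 ⌊R (Fin.last t)⌋₊, |((ArithmeticFunction.moebius x : ℤ) : ℝ)| *
          (((Lam : ℕ) : ℝ) ^ (x.primeFactors \ P).card * ∏ p ∈ x.primeFactors \ P, (1 : ℝ) / p)
      ≤ Real.log Rmax * E₀ * (2 ^ P.card * (Real.exp (4 * Lam) * Real.log ((⌊R (Fin.last t)⌋₊ : ℕ) : ℝ) ^ Lam)) :=
        mul_le_mul_of_nonneg_left hsum (mul_nonneg hL0 hE₀0)
    _ ≤ Real.log Rmax * E₀ * (2 ^ P.card * (Real.exp (4 * Lam) * Real.log Rmax ^ Lam)) :=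
        mul_le_mul_of_nonneg_left (mul_le_mul_of_nonneg_left (mul_le_mul_of_nonneg_left hpowX (Real.exp_nonneg _))
          (by positivity)) (mul_nonneg hL0 hE₀0)
    _ = _ := by rw [hE₀]; ring

end Summit.Parity.GeneralizedHardyLittlewood.Cruxes.RelativeDimOne.SingleMoebiusSplit

end
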